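import Literature.Topology.FourManifolds.GluckTwistHomologyProofs
import Literature.Topology.FourManifolds.HomotopyS4Criterion
import HarnessLib

/-!
# `H₃` of a Gluck twist vanishes (proved); `Σ_K ≃ₕ S⁴` from Whitehead's theorem and CW type only

Sibling proof file of `GluckTwist.lean` / `GluckTwistHomologyProofs.lean` /
`GluckTwistHomotopySphere.lean` in the decomposition (D-0014 provefact, SIZE XL) of the named fact
`Literature.Topology.FourManifolds.nonempty_homeomorph_sphere_of_isGluckTwist` (`Σ_K ≃ₜ S⁴` for
every Gluck twist `Σ_K` of `S⁴` along a 2-knot `K`; H. Gluck, Trans. AMS 104 (1962), §17, with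
M. Freedman, J. Differential Geom. 17 (1982), Thm. 1.6). It concerns the intermediate named fact
`Literature.Topology.FourManifolds.nonempty_homotopyEquiv_sphere_of_isGluckTwist` (Gluck 1962, §17
proper: *a Gluck twist is a homotopy 4-sphere*; Kirby, LNM 1374 (1989), Ch. I §6, p. 16).

So far that fact was reduced (`nonempty_homotopyEquiv_sphere_of_isGluckTwist_of_spc4`) to the
`π₁`/`H₂` characterisation of homotopy 4-spheres `nonempty_homotopyEquiv_sphere_four_iff`
(`spc4.S10`), whose hard direction rests in `HomotopyS4Criterion.lean` on three named facts:
Poincaré duality (Hatcher Thm. 3.30, `bijective_poincareDualityMap`, used only to get `H₃(M) = 0`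
from `H₁(M) = 0`), Whitehead's theorem (Cor. 4.33, `whitehead_exists_homotopyEquiv`) and the CW
homotopy type of compact manifolds (Cor. A.12, `exists_cwComplex_homotopyEquiv_of_compactSpace`).
For a Gluck twist the Poincaré duality input is superfluous: **`H₃(Σ_K; ℤ) = 0` is computed
directly**, by the two Mayer–Vietoris steps that gave `H₂(Σ_K; ℤ) = 0` in
`GluckTwistHomologyProofs.lean`, one degree up (Gluck 1962, §17: `Σ_K` has the integral homology
of `S⁴`). This file proves it and deduces `Σ_K ≃ₕ S⁴` from Cor. 4.33 and Cor. A.12 alone.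

## Contents (all proved; nothing is asserted, no new named fact, no `def`)

1. Models: `H₃(S₊) = 0` for `S₊ = (S² ∖ s) × (ℝ² ∖ 0) ≃ ℝ² ∖ 0` and `H₂(T) = 0` for `T ≅ ℝ⁴ ∖ pt`.
2. `H₃(S⁴ ∖ K(S²); M) = 0` for a tubed 2-knot
   (`TwoKnot.TubularNbhd.isZero_csingularHomology_complement_three`; Mayer–Vietoris for
   `S⁴ ∖ {K(s)} = (S⁴ ∖ K) ∪ ν(D₊ × ℝ²)`; the case `(4, 2, 3)` of Hatcher Prop. 2B.1(b)).
3. The Gluck twist `X = W ∪ jB(D₋ × ℝ²)`, `W = jA(S⁴ ∖ K) ∪ jB(D₊ × ℝ²)` (`GluckDatum` of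
   `GluckTwistHomology.lean`): `H₃(W) = 0`, `H₃(X) = 0` (concrete homology, `X : Type`), the
   comparison with Mathlib's model, transport of a Gluck datum along a homeomorphism
   (`GluckDatum.nonempty_comp_homeomorph`) and **`isZero_singularHomology_three_of_isGluckTwist`:
   `H₃(Σ_K; M) = 0` for every Gluck twist, in every universe, for every model, all coefficients**.
4. The hard direction of `spc4.S10` WITHOUT Poincaré duality, for closed simply connected
   topological 4-manifolds `M : Type` with `H₂(M) = H₃(M) = 0`:
   `exists_map_sphere_four_isIso_of_isZero` (a homology equivalence `M → S⁴`, proved outright) and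
   `nonempty_homotopyEquiv_sphere_four_of_isZero` (`M ≃ₕ S⁴` GIVEN `hW`, `hCW`).
5. **`nonempty_homotopyEquiv_sphere_of_isGluckTwist_of_whitehead`**: Gluck 1962, §17 at every
   universe from `whitehead_exists_homotopyEquiv.{0}` and
   `exists_cwComplex_homotopyEquiv_of_compactSpace.{0}` alone (universe-`0` case plus the universe
   lift `nonempty_homotopyEquiv_sphere_of_isGluckTwist_of_univ_zero`).

With the sibling file `GluckTwistFreedman.lean` (the homeomorphism `Σ_K ≃ₜ S⁴` from Freedman's
Cor. 1.2 alone) the census of the decomposition reads: every Gluck-specific statement of Gluck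
1962, §17 used by the tree (compactness, `π₁ = 1`, `H₂ = 0`, `H₃ = 0`) is a theorem; the
homotopy-sphere fact rests on Hatcher Cor. 4.33 + Cor. A.12 (or on Freedman's Cor. 1.2), the
homeomorphism fact on Freedman's Cor. 1.2.

## References

* H. Gluck, *The embedding of two-spheres in the four-sphere*, Trans. Amer. Math. Soc. 104 (1962)
  308–333, §17 [GluckTAMS1962].
* A. Hatcher, *Algebraic Topology*, CUP 2002, §2.2 pp. 149–150, Cor. 2.14, Prop. 2B.1(b),
  Thm. 2A.1, Prop. 3.25, Thm. 3.26, Cor. 4.33, Cor. A.12 [HatcherAT2002].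
* M. H. Freedman, F. Quinn, *Topology of 4-manifolds* (1990), §10.1 [FreedmanQuinnPMS1990];
  R. C. Kirby, *The Topology of 4-Manifolds*, LNM 1374 (1989), Ch. I §6, p. 16 [Kirby1989].

## Design notes

As in `GluckTwistHomologyProofs.lean`: the Mayer–Vietoris computation runs in the concrete model
`csingularHomology` for `X : Type` and arbitrary coefficients, is compared with Mathlib's singular
homology by `csingularHomology.compIso`, and is moved to any universe along `Shrink.{0} X ≃ₜ X` by
the cross-universe `csingularHomology.isZero_of_homeomorph`; for `H₃` no smooth structure is
needed in the transport. No declaration in this file uses `sorry`.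
-/

noncomputable section

open CategoryTheory Limits Set Function
open scoped Manifold ContDiff ContinuousMap
open _root_.Topology

universe u v w

namespace Literature.Topology.FourManifolds

variable (R : Type v) [CommRing R] (M : Type v) [AddCommGroup M] [Module R M]

open SphereTwo

/-! ### §1 The models `S₊ ≃ ℝ² ∖ 0` and `T ≃ ℝ⁴ ∖ 0`, one degree up -/

section Models

/-- **`H₃(S₊; M) = 0`** for the model `S₊ = (S² ∖ {s}) × (ℝ² ∖ 0) ≃ ℝ² ∖ 0` of
`GluckTwistHomology.lean` (`GluckDatum.modelS`): drop the contractible factor and use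
`H₃(ℝ² ∖ 0) = 0` (`isZero_homology_punctured`, degree above the dimension; Hatcher 2002,
Cor. 2.14 with Prop. 2.22). [cite: HatcherAT2002, Cor. 2.14] -/
theorem isZero_csingularHomology_modelS_three :
    IsZero (Literature.AlgebraicTopology.SingularHomology.csingularHomology R M
      ↥GluckDatum.modelS 3) :=
  (Literature.AlgebraicTopology.SingularHomology.isZero_homology_punctured R M 2 3 (by norm_num)
      (by norm_num)).of_iso <|
    (Literature.AlgebraicTopology.SingularHomology.csingularHomology.mapIso R M
        GluckDatum.modelSHomeomorph 3).trans <|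
      (Literature.AlgebraicTopology.SingularHomology.csingularHomology.isoOfHomotopyEquiv R M
        (HomotopyEquiv.sndOfContractible (↥(GluckDatum.Dplus : Set (Metric.sphere
          (0 : EuclideanSpace ℝ (Fin (2 + 1))) 1))) {w : EuclideanSpace ℝ (Fin 2) // w ≠ 0})
          3).trans
        (Literature.AlgebraicTopology.SingularHomology.csingularHomology.mapIso R M
          (GluckDatum.puncturedEuclideanHomeomorph 2) 3)

/-- **`H₂(T; M) = 0`** for the model `T ≅ ((S² ∖ {n}) × ℝ²) ∖ {(s, 0)} ≅ ℝ⁴ ∖ {pt}` of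
`GluckTwistHomology.lean` (`GluckDatum.modelT`), by `H₂(ℝ⁴ ∖ 0) = 0`
(`isZero_homology_punctured_of_succ_ne` of `…ExcisionMayerVietorisProofs`; Hatcher 2002,
Cor. 2.14: `H₂(S³) = 0`). [cite: HatcherAT2002, Cor. 2.14] -/
theorem isZero_csingularHomology_modelT_two :
    IsZero (Literature.AlgebraicTopology.SingularHomology.csingularHomology R M
      ↥GluckDatum.modelT 2) :=
  (Literature.AlgebraicTopology.SingularHomology.isZero_homology_punctured_of_succ_ne R M 2 4
      (by norm_num) (by norm_num)).of_iso <|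
    Literature.AlgebraicTopology.SingularHomology.csingularHomology.mapIso R M
      (GluckDatum.modelTHomeomorph.trans <| GluckDatum.puncturedProdHomeomorph.trans <|
        (GluckDatum.puncturedProdHomeomorph' _).trans <|
          GluckDatum.puncturedProdHomeomorphEuclidean.trans
            (GluckDatum.puncturedEuclideanHomeomorph 4)) 2

end Models

/-! ### §2 `H₃(S⁴ ∖ K) = 0` for a tubed 2-knot -/

section SphereFour

variable {K : TwoKnot}

/-- **`H₃(S⁴ ∖ K(S²); M) = 0`** for a 2-knot with a tubular neighbourhood `ν`: Mayer–Vietoris for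
`S⁴ ∖ {K(s)} = (S⁴ ∖ K) ∪ ν(D₊ × ℝ²)` (exactness at `H₃(S⁴ ∖ K) ⊕ H₃(ν(D₊ × ℝ²))`,
`isZero_csingularHomology_of_union_of_inter`): the union is `S⁴` minus a point (contractible) and
the intersection is `ν(D₊ × (ℝ² ∖ 0)) ≃ ℝ² ∖ 0`, with `H₃(ℝ² ∖ 0) = 0`. This is the case
`(n, k, i) = (4, 2, 3)` of Hatcher 2002, Prop. 2B.1(b) (`H̃ᵢ(S⁴ ∖ h(S²)) = 0` for `i ≠ 1`), for
tubed (e.g. smooth) knots. [cite: HatcherAT2002, §2.2 p. 149 and Prop. 2B.1(b)] -/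
theorem TwoKnot.TubularNbhd.isZero_csingularHomology_complement_three
    (ν : TwoKnot.TubularNbhd K) :
    IsZero (Literature.AlgebraicTopology.SingularHomology.csingularHomology R M K.complement 3) :=
  Literature.AlgebraicTopology.SingularHomology.isZero_csingularHomology_of_union_of_inter R M
    K.isClosed_range.isOpen_compl ν.isOpen_capPlus 3
    (Literature.AlgebraicTopology.SingularHomology.isZero_csingularHomology_of_contractibleSpace R M
      three_ne_zero)
    ((isZero_csingularHomology_modelS_three R M).of_iso
      (Literature.AlgebraicTopology.SingularHomology.csingularHomology.mapIso R M
        ν.modelSHomeomorphInter 3).symm)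

end SphereFour

/-! ### §3 The Gluck twist: `H₃(Σ_K; M) = 0` -/

section GluckTwist

variable {X : Type} [TopologicalSpace X] {K : TwoKnot}

namespace GluckDatum

/-- **Step 1: `H₃(W; M) = 0`** for `W = jA(S⁴ ∖ K) ∪ jB(D₊ × ℝ²)`, by Mayer–Vietoris
(`isZero_csingularHomology_union_of_mono` in degree `2 + 1`): `H₃(S⁴ ∖ K) = 0`
(`TwoKnot.TubularNbhd.isZero_csingularHomology_complement_three`), `D₊ × ℝ²` is contractible, and
`H₂(jA(S⁴ ∖ K) ∩ jB(D₊ × ℝ²)) = H₂(S₊) = 0` (`isZero_csingularHomology_modelS_two`), so the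
required injectivity on `H₂` holds trivially. [cite: HatcherAT2002, §2.2 p. 149] -/
theorem isZero_csingularHomology_pieceW_three (G : GluckDatum X K) :
    IsZero (Literature.AlgebraicTopology.SingularHomology.csingularHomology R M ↥G.pieceW 3) := by
  refine Literature.AlgebraicTopology.SingularHomology.isZero_csingularHomology_union_of_mono R M
    G.hAo (G.isOpen_pieceB isOpen_compl_singleton) 2
    ((G.ν.isZero_csingularHomology_complement_three R M).of_iso
      (Literature.AlgebraicTopology.SingularHomology.csingularHomology.mapIso R M
        G.hA.toHomeomorph 3).symm)
    (Literature.AlgebraicTopology.SingularHomology.isZero_csingularHomology_of_contractibleSpace R M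
      three_ne_zero) ?_
  have h0 : IsZero (Literature.AlgebraicTopology.SingularHomology.csingularHomology R M
      ↥(range G.jA ∩ G.pieceB Dplus) 2) :=
    (isZero_csingularHomology_modelS_two R M).of_iso
      (Literature.AlgebraicTopology.SingularHomology.csingularHomology.mapIso R M
        G.modelSHomeomorphInter 2).symm
  exact h0.mono _

/-- **Step 2: `H₃(X; M) = 0`** by Mayer–Vietoris for `X = W ∪ jB(D₋ × ℝ²)` (`isZero_of_mv` in
degree `2 + 1`): `H₃(W) = 0` (step 1), `jB(D₋ × ℝ²)` is contractible and
`W ∩ jB(D₋ × ℝ²) = jB((D₋ × ℝ²) ∖ {(s, 0)}) ≅ ℝ⁴ ∖ {pt}` has `H₂ = 0`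
(`isZero_csingularHomology_modelT_two`). [cite: HatcherAT2002, §2.2 p. 149] -/
theorem isZero_csingularHomology_three (G : GluckDatum X K) :
    IsZero (Literature.AlgebraicTopology.SingularHomology.csingularHomology R M X 3) := by
  have h := Literature.AlgebraicTopology.SingularHomology.isZero_of_mv R M G.isOpen_pieceW
    (G.isOpen_pieceB isOpen_compl_singleton) 2
    (G.isZero_csingularHomology_pieceW_three R M)
    (Literature.AlgebraicTopology.SingularHomology.isZero_csingularHomology_of_contractibleSpace R M
      three_ne_zero)
    ((isZero_csingularHomology_modelT_two R M).of_iso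
      (Literature.AlgebraicTopology.SingularHomology.csingularHomology.mapIso R M
        ((Homeomorph.setCongr G.pieceW_inter_pieceB).trans
          (G.hB.homeomorphImage modelT).symm) 2))
  exact h.of_iso (Literature.AlgebraicTopology.SingularHomology.csingularHomology.mapIso R M
    ((Homeomorph.setCongr G.pieceW_union_pieceB).trans (Homeomorph.Set.univ X)) 3).symm

/-- **`H₃(X; M) = 0` for Mathlib's singular homology** (comparison isomorphism
`csingularHomology.compIso`). [cite: GluckTAMS1962, §17] -/
theorem isZero_singularHomology_degree_three (G : GluckDatum X K) :
    IsZero (Literature.AlgebraicTopology.SingularHomology.singularHomology R M X 3) :=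
  (G.isZero_csingularHomology_three R M).of_iso
    (Literature.AlgebraicTopology.SingularHomology.csingularHomology.compIso R M X 3).symm

end GluckDatum

omit [TopologicalSpace X] in
/-- **Transport of a Gluck datum along a homeomorphism**: post-composing the two gluing
embeddings `jA`, `jB` of a Gluck datum on `Y` with a homeomorphism `φ : Y ≃ₜ Z` gives a Gluck
datum on `Z` (same tubular neighbourhood, same gluing relation). Used with `Z = Shrink.{0} Y` to
move the `Type`-bound Mayer–Vietoris computation to any universe; unlike the transport of the
*smooth* Gluck structure (`IsGluckTwist.of_diffeomorph`, `GluckTwistMeridian.lean`) no manifold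
structure is involved. [folklore] -/
theorem GluckDatum.nonempty_comp_homeomorph {Y : Type u} {Z : Type w} [TopologicalSpace Y]
    [TopologicalSpace Z] (G : GluckDatum Y K) (φ : Y ≃ₜ Z) : Nonempty (GluckDatum Z K) :=
  ⟨{ ν := G.ν
     jA := φ ∘ G.jA
     jB := φ ∘ G.jB
     hA := φ.isEmbedding.comp G.hA
     hAo := by rw [range_comp]; exact φ.isOpenMap _ G.hAo
     hB := φ.isEmbedding.comp G.hB
     hBo := by rw [range_comp]; exact φ.isOpenMap _ G.hBo
     hU := by rw [range_comp, range_comp, ← image_union, G.hU, image_univ, φ.range_coe]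
     hR := fun a b => by rw [Function.comp_apply, Function.comp_apply, φ.injective.eq_iff, G.hR] }⟩

/-- **Gluck 1962, §17: `H₃(Σ_K; M) = 0` for every Gluck twist — proved**, in every universe, for
every model `IX` and all coefficients: a Gluck twist `Y : Type u` is small (`IsGluckTwist.small`),
a Gluck datum of `Y` (`IsGluckTwist.nonempty_gluckDatum`) is transported to the homeomorphic copy
`Shrink.{0} Y : Type` (`GluckDatum.nonempty_comp_homeomorph`), where `H₃ = 0` by
`GluckDatum.isZero_csingularHomology_three`, and the vanishing is moved back across universes
(`csingularHomology.isZero_of_homeomorph`, `csingularHomology.compIso`). (Printed argument, Gluck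
1962 §17 / Gompf–Stipsicz Ex. 6.2.2: `(S⁴ ∖ νK) ∪_τ (S² × D²)` has the homology of
`S⁴ = (S⁴ ∖ νK) ∪_{id} (S² × D²)` since `τ` acts trivially on `H_*(S² × S¹)`.)
[cite: GluckTAMS1962, §17] -/
theorem isZero_singularHomology_three_of_isGluckTwist {EX HX : Type*} [NormedAddCommGroup EX]
    [NormedSpace ℝ EX] [TopologicalSpace HX] {IX : ModelWithCorners ℝ EX HX} {Y : Type u}
    [TopologicalSpace Y] [ChartedSpace HX Y] (hY : IsGluckTwist IX Y K) :
    IsZero (Literature.AlgebraicTopology.SingularHomology.singularHomology R M Y 3) := by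
  haveI : Small.{0} Y := hY.small
  let φ : Y ≃ₜ Shrink.{0} Y := Shrink.homeomorph Y
  obtain ⟨G⟩ := hY.nonempty_gluckDatum
  obtain ⟨G'⟩ := G.nonempty_comp_homeomorph φ
  have h0 : IsZero (Literature.AlgebraicTopology.SingularHomology.csingularHomology R M
      (Shrink.{0} Y) 3) :=
    G'.isZero_csingularHomology_three R M
  exact (Literature.AlgebraicTopology.SingularHomology.csingularHomology.isZero_of_homeomorph R M
    φ.symm h0).of_iso
      (Literature.AlgebraicTopology.SingularHomology.csingularHomology.compIso R M Y 3).symm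

end GluckTwist

/-! ### §4 The hard direction of `spc4.S10` without Poincaré duality -/

section SPC4

/-- **A homology equivalence `M → S⁴` from `H₂(M) = H₃(M) = 0`, proved outright.** Let `M : Type`
be a closed simply connected topological 4-manifold with `H₂(M; ℤ) = 0` and `H₃(M; ℤ) = 0`. Then
there is a continuous map `f : M → S⁴` inducing isomorphisms on all `Hₖ(-; ℤ)`: the collapse map
of a coordinate ball is an isomorphism on `H₄` (orientability Prop. 3.25, fundamental class
Thm. 3.26(a), `exists_isIso_map_sphere_of_isFundamentalClass` — all proved) and on `H₀`;
`H₁(M) = 0` (Thm. 2A.1, proved), `H₂(M) = H₃(M) = 0` (hypotheses), `Hₖ(M) = 0` for `k ≥ 5`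
(Thm. 3.26(c), proved), `Hₖ(S⁴) = 0` for `k ≠ 0, 4` (Cor. 2.14, proved). This is
`exists_map_sphere_four_isIso_of_poincareDuality` (`HomotopyS4Criterion.lean`) with its single use
of Poincaré duality (Thm. 3.30: `H₃ ≅ H¹ = 0`) replaced by the hypothesis `H₃(M) = 0`.
[cite: HatcherAT2002, Thm. 3.26, Prop. 3.25, Thm. 2A.1, Cor. 2.14] -/
theorem exists_map_sphere_four_isIso_of_isZero {M : Type} [TopologicalSpace M]
    [T2Space M] [CompactSpace M] [ChartedSpace (EuclideanSpace ℝ (Fin 4)) M]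
    [SimplyConnectedSpace M]
    (hH₂ : IsZero (Literature.AlgebraicTopology.SingularHomology.singularHomology ℤ ℤ M 2))
    (hH₃ : IsZero (Literature.AlgebraicTopology.SingularHomology.singularHomology ℤ ℤ M 3)) :
    ∃ f : C(M, Metric.sphere (0 : EuclideanSpace ℝ (Fin (4 + 1))) 1),
      ∀ k : ℕ, IsIso (Literature.AlgebraicTopology.SingularHomology.singularHomology.map ℤ ℤ f k) := by
  obtain ⟨μ⟩ : Literature.AlgebraicTopology.SingularHomology.IsOrientableOver ℤ M 4 :=
    Literature.AlgebraicTopology.SingularHomology.isOrientableOver_int_of_simplyConnectedSpace_holds M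
  obtain ⟨c, hc⟩ := Literature.AlgebraicTopology.SingularHomology.exists_isFundamentalClass μ
  -- the collapse map is an isomorphism on `H₄`
  obtain ⟨f, hf4⟩ :=
    Literature.AlgebraicTopology.SingularHomology.exists_isIso_map_sphere_of_isFundamentalClass ℤ
      (n := 4) (by norm_num) μ hc
  -- homology of `M` and of `S⁴` outside degrees `0`, `4`
  have h1 : IsZero (Literature.AlgebraicTopology.SingularHomology.singularHomology ℤ ℤ M 1) :=
    Literature.AlgebraicTopology.SingularHomology.isZero_singularHomology_one_of_simplyConnectedSpace
      ℤ ℤ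
  have hM : ∀ k, k ≠ 0 → k ≠ 4 →
      IsZero (Literature.AlgebraicTopology.SingularHomology.singularHomology ℤ ℤ M k) := by
    intro k hk0 hk4
    have hk1 : 1 ≤ k := Nat.pos_of_ne_zero hk0
    rcases Nat.lt_or_gt_of_ne hk4 with hk | hk
    · interval_cases k
      · exact h1
      · exact hH₂
      · exact hH₃
    · exact Literature.AlgebraicTopology.SingularHomology.isZero_singularHomology_of_lt_holds ℤ ℤ M
        4 hk
  have hS : ∀ k, k ≠ 0 → k ≠ 4 → IsZero (Literature.AlgebraicTopology.SingularHomology.singularHomology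
      ℤ ℤ (Metric.sphere (0 : EuclideanSpace ℝ (Fin (4 + 1))) 1) k) := fun k hk0 hk4 =>
    Literature.AlgebraicTopology.SingularHomology.isZero_singularHomology_sphere_holds ℤ ℤ hk0 hk4
  -- `f` is a homology isomorphism
  haveI : PathConnectedSpace (Metric.sphere (0 : EuclideanSpace ℝ (Fin (4 + 1))) 1) :=
    Literature.AlgebraicTopology.SingularHomology.pathConnectedSpace_sphere (n := 4) (by norm_num)
  refine ⟨f, fun k => ?_⟩
  by_cases hk0 : k = 0
  · subst hk0
    exact Literature.AlgebraicTopology.SingularHomology.singularHomology.isIso_map_zero_of_pathConnectedSpace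
      ℤ ℤ f
  by_cases hk4 : k = 4
  · subst hk4
    exact hf4
  exact IsZero.isIso (hM k hk0 hk4) (hS k hk0 hk4) _

/-- **(⇐) of `spc4.S10` without Poincaré duality** (Freedman–Quinn 1990, §10.1; Hatcher 2002,
Exercise 4.2.15 for the 3-dimensional analogue). A closed simply connected topological 4-manifold
`M : Type` with `H₂(M; ℤ) = H₃(M; ℤ) = 0` is homotopy equivalent to `S⁴`, GIVEN Whitehead's
theorem (`hW`, Hatcher Cor. 4.33) and the CW homotopy type of compact manifolds (`hCW`,
Cor. A.12): the homology equivalence `f : M → S⁴` of `exists_map_sphere_four_isIso_of_isZero` is a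
homotopy equivalence, both spaces being simply connected closed manifolds
(`Literature.AlgebraicTopology.Homotopy.exists_homotopyEquiv_of_isIso_map_of_closedManifold`).
[cite: HatcherAT2002, Cor. 4.33 and Cor. A.12] [cite: FreedmanQuinnPMS1990, §10.1] -/
theorem nonempty_homotopyEquiv_sphere_four_of_isZero {M : Type} [TopologicalSpace M] [T2Space M]
    [CompactSpace M] [ChartedSpace (EuclideanSpace ℝ (Fin 4)) M] [SimplyConnectedSpace M]
    (hH₂ : IsZero (Literature.AlgebraicTopology.SingularHomology.singularHomology ℤ ℤ M 2))
    (hH₃ : IsZero (Literature.AlgebraicTopology.SingularHomology.singularHomology ℤ ℤ M 3))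
    (hW : Literature.AlgebraicTopology.Homotopy.whitehead_exists_homotopyEquiv.{0})
    (hCW : Literature.AlgebraicTopology.Homotopy.exists_cwComplex_homotopyEquiv_of_compactSpace.{0}) :
    Nonempty (M ≃ₕ Metric.sphere (0 : EuclideanSpace ℝ (Fin (4 + 1))) 1) := by
  obtain ⟨f, hiso⟩ := exists_map_sphere_four_isIso_of_isZero hH₂ hH₃
  haveI : SimplyConnectedSpace (Metric.sphere (0 : EuclideanSpace ℝ (Fin (4 + 1))) 1) :=
    simplyConnectedSpace_sphere_four_holds
  obtain ⟨e, -⟩ :=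
    Literature.AlgebraicTopology.Homotopy.exists_homotopyEquiv_of_isIso_map_of_closedManifold
      (m := 4) (n := 4) hW hCW f hiso
  exact ⟨e⟩

end SPC4

/-! ### §5 Gluck 1962, §17 from Whitehead's theorem and the CW type alone -/

section Assembly

variable {K : TwoKnot}

/-- **A Gluck twist is a homotopy 4-sphere (Gluck 1962, §17), universe `0`, from Whitehead's
theorem and the CW homotopy type of compact manifolds alone**: a Gluck twist `X : Type` is compact,
simply connected, with `H₂(X; ℤ) = 0` and `H₃(X; ℤ) = 0` (`IsGluckTwist.compactSpace_holds`,
`simplyConnectedSpace_of_isGluckTwist_holds`, `isZero_singularHomologyZ_two_of_isGluckTwist_holds`,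
`isZero_singularHomology_three_of_isGluckTwist` — all proved), so
`nonempty_homotopyEquiv_sphere_four_of_isZero` applies (Kirby 1989, Ch. I §6, p. 16: "The result
`Q⁴(Θ)` is easily seen to be a homotopy 4-sphere"). [cite: GluckTAMS1962, §17]
[cite: Kirby1989, Ch. I §6, p. 16] [cite: HatcherAT2002, Cor. 4.33 and Cor. A.12] -/
theorem nonempty_homotopyEquiv_sphere_of_isGluckTwist_univ_zero_of_whitehead
    (hW : Literature.AlgebraicTopology.Homotopy.whitehead_exists_homotopyEquiv.{0})
    (hCW : Literature.AlgebraicTopology.Homotopy.exists_cwComplex_homotopyEquiv_of_compactSpace.{0}) :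
    nonempty_homotopyEquiv_sphere_of_isGluckTwist.{0} (K := K) := by
  intro X _ _ _ _ _ h
  haveI : CompactSpace X := IsGluckTwist.compactSpace_holds h
  haveI : SimplyConnectedSpace X := simplyConnectedSpace_of_isGluckTwist_holds h
  exact nonempty_homotopyEquiv_sphere_four_of_isZero
    (isZero_singularHomologyZ_two_of_isGluckTwist_holds h)
    (isZero_singularHomology_three_of_isGluckTwist ℤ ℤ h) hW hCW

/-- **Universe lift for the homotopy-4-sphere fact**: `nonempty_homotopyEquiv_sphere_of_isGluckTwist`
at universe `0` implies it at every universe `u` — a Gluck twist `X : Type u` is small,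
`Shrink.{0} X : Type` carries the transported `C^∞` structure and is again a Gluck twist along `K`
(`Homeomorph.transportDiffeomorph`, `IsGluckTwist.of_diffeomorph`, `GluckTwistMeridian.lean`), hence
`≃ₕ S⁴`, and a homeomorphism is a homotopy equivalence (same transport as
`nonempty_homeomorph_sphere_of_isGluckTwist_of_univ_zero`). [folklore] -/
theorem nonempty_homotopyEquiv_sphere_of_isGluckTwist_of_univ_zero
    (h0 : nonempty_homotopyEquiv_sphere_of_isGluckTwist.{0} (K := K)) :
    nonempty_homotopyEquiv_sphere_of_isGluckTwist.{u} (K := K) := by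
  intro X _ _ _ _ _ hX
  haveI : Small.{0} X := hX.small
  let φ : X ≃ₜ Shrink.{0} X := Shrink.homeomorph X
  letI : ChartedSpace (EuclideanSpace ℝ (Fin 4)) (Shrink.{0} X) :=
    Homeomorph.transportChartedSpace φ
  haveI : IsManifold (𝓡 4) ∞ (Shrink.{0} X) :=
    Homeomorph.isManifold_transportChartedSpace (I₀ := 𝓡 4) (n := ∞) φ
  haveI : T2Space (Shrink.{0} X) := φ.t2Space
  haveI : SecondCountableTopology (Shrink.{0} X) := φ.symm.secondCountableTopology
  have h' : IsGluckTwist (𝓡 4) (Shrink.{0} X) K :=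
    hX.of_diffeomorph (Homeomorph.transportDiffeomorph (I₀ := 𝓡 4) (n := ∞) φ)
  obtain ⟨e⟩ := h0 h'
  exact ⟨φ.toHomotopyEquiv.trans e⟩

/-- **Gluck 1962, §17 (`Σ_K ≃ₕ S⁴`) at every universe from Whitehead's theorem (Hatcher
Cor. 4.33) and the CW homotopy type of compact manifolds (Cor. A.12) at universe `0` alone** — the
named fact `nonempty_homotopyEquiv_sphere_of_isGluckTwist.{u}` no longer depends on Poincaré
duality: `nonempty_homotopyEquiv_sphere_of_isGluckTwist_univ_zero_of_whitehead` lifted by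
`nonempty_homotopyEquiv_sphere_of_isGluckTwist_of_univ_zero`.
[cite: GluckTAMS1962, §17] [cite: HatcherAT2002, Cor. 4.33 and Cor. A.12] -/
theorem nonempty_homotopyEquiv_sphere_of_isGluckTwist_of_whitehead
    (hW : Literature.AlgebraicTopology.Homotopy.whitehead_exists_homotopyEquiv.{0})
    (hCW : Literature.AlgebraicTopology.Homotopy.exists_cwComplex_homotopyEquiv_of_compactSpace.{0}) :
    nonempty_homotopyEquiv_sphere_of_isGluckTwist.{u} (K := K) :=
  nonempty_homotopyEquiv_sphere_of_isGluckTwist_of_univ_zero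
    (nonempty_homotopyEquiv_sphere_of_isGluckTwist_univ_zero_of_whitehead hW hCW)

end Assembly

end Literature.Topology.FourManifolds

end
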